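import Summits.ResolutionOfSingularities.ResolutionOfSingularities.Theorems.EquisingularLiftEquisingularLiftNatNosePGRung
import Summits.ResolutionOfSingularities.ResolutionOfSingularities.Theorems.EquisingularLiftEquisingularLiftNatNoseLiftSupplier
import Summits.ResolutionOfSingularities.ResolutionOfSingularities.Theorems.EquisingularLiftEquisingularLiftNatSecCurveLift
import HarnessLib

/-!
# [OURS · L1 W4.5(b) · EL♮(3) · WIDTH TABLE D15 «ν-LIFT DOOR», rung row] RUNG^{νLIFT} ★★ `nose_lift_rung_three`
# `(T-k) → p.Prime → ∀ k … → NoseHypHostedNestEquinodalDirectCILiftSigmaPGBTriplePrime₂ k 3 H ι → ELNatConclusionO k 3 H ι` (binder = RUNGᶜⁱ's VERBATIM)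

res-L1-w45b-nose-w1 g7 (WIDTH seat D-0157 DOOR 1; desk RULING R78 (iii)/(iv) 2026-08-29T10:25:06Z; module name per the desk).  = res-L1-w45b-stub-2's RUNG^{ΣPG}
✓ `nose_secpg_rung_three` (…NatNosePGRung) BYTE-FOR-BYTE with: the blob token `…DirectCISigmaPGBTriplePrime₂ ↦ …DirectCILiftSigmaPGBTriplePrime₂` (res-type-027
DefsE8), `ReachI := ((ν4 ∨ ν3ᵈΣPG) ∨ ν3ᶜⁱΣPG) ∨ ReachLiftNoseSigmaPG₂ k 3 H ι (range ι)`, and ONE more `Or.elim` arm served by ✓ `LiftNose.hsublift_of_door`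
(…NatNoseLiftSupplier); both licences discharged inside (variant (b): the Σ-licence by ✓ `SecCurve.secCurveLift k` from
✓ `…NatSecCurveLift`, imported EXPLICITLY here since res-L1-w45b-stub-2's re-cut (4′) no longer imports it); ZERO change to the K5ⁱ engine ✓ `target_elnat_of_hostedSubchainResolutionᵢ`.
OURS; NOT a statement of any manuscript ([Hironaka2017] is a candidate under adjudication, nothing of it is asserted); AI-written, weaker than expert review.
No `sorry`; standard axioms; DEF-FREE; the ONLY hypothesis is (T-k) `EmbeddedCurveLiftFact` (the registered `stub_elnat_embeddedCurveLiftFact`).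
`--supports stmt-ResolutionOfSingularities-20148 --as helper`, counted 0.  EL♮(3) is NOT proved here: after the D15 REPLACE the nose residue reads
`¬ NoseHypHostedNestEquinodalDirectCILiftSigmaPGBTriplePrime₂`; resolution of singularities in positive characteristic is NOT proved anywhere in this tree
(dim 3 in print: Cossart–Piltant 2008/2009). [folklore; pure composition of ✓ modules]
-/

set_option linter.dupNamespace false -- mandated namespace `Summit.<Summit>.<Problem>` of this single-conjunct summit
set_option linter.overlappingInstances false -- signatures carry `[IsDomain O] [IsDiscreteValuationRing O]`

noncomputable section

open CategoryTheory CategoryTheory.Limits AlgebraicGeometry TopologicalSpace Topology IsLocalRing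
open MvPolynomial
open Literature.AlgebraicGeometry.Resolution
open AlgebraicGeometry.Scheme.IdealSheafData
open Summit.ResolutionOfSingularities.ResolutionOfSingularities.Theses.EquisingularLift.Split
open Summit.ResolutionOfSingularities.ResolutionOfSingularities.Cruxes.EquisingularLift.StrataSplit

namespace Summit.ResolutionOfSingularities.ResolutionOfSingularities.Cruxes.EquisingularLiftNat.Sections

/-- ★★ **THE RUNG (R-νLIFT) `nose_lift_rung_three`: surfaces `H ⊂ ℙ³_k` whose downstairs nose resolution uses the initial menu «((ν4 ∨ ν3ᵈΣPG) ∨ ν3ᶜⁱΣPG) ∨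
νLIFT» (res-type-027's blob E8 `NoseHypHostedNestEquinodalDirectCILiftSigmaPGBTriplePrime₂`, WIDTH TABLE D15 «ν-LIFT DOOR», desk R78) satisfy EL♮(3)'s
conclusion, GIVEN (T-k).**  = ✓ `nose_secpg_rung_three` (res-L1-w45b-stub-2 (4′)) with ONE more `Or.elim` arm served by `LiftNose.hsublift_of_door`; binder
convention = RUNGᶜⁱ's VERBATIM, blob token swapped (desk kit call: `nose_lift_rung_three p stub_elnat_embeddedCurveLiftFact hp k H ι hι hH hloc hLIFT`).
ONE call of ✓ K5ⁱ `target_elnat_of_hostedSubchainResolutionᵢ` with `ReachI := ((ν4 ∨ ν3ᵈΣPG) ∨ ν3ᶜⁱΣPG) ∨ νLIFT` — zero engine change; both licences inside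
(variant (b)). [OURS · L1 W4.5b · rung of the D15 REPLACE «¬blob_ΣPG ↦ ¬blob_E8»; NOT a statement of the manuscript; EL♮(3) NOT proved] -/
theorem nose_lift_rung_three (p : ℕ) : EmbeddedCurveLiftFact → p.Prime →
    ∀ (k : Type) [Field k] [CharP k p] [IsAlgClosed k] (H : AlgebraicGeometry.Scheme.{0})
    (ι : H ⟶ (Literature.AlgebraicGeometry.Motives.projectiveSpace 3 k).left),
    AlgebraicGeometry.IsClosedImmersion ι → AlgebraicGeometry.IsIntegral H →
    (∀ y : (Literature.AlgebraicGeometry.Motives.projectiveSpace 3 k).left,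
      ∃ U : (Literature.AlgebraicGeometry.Motives.projectiveSpace 3 k).left.affineOpens,
        y ∈ (U : (Literature.AlgebraicGeometry.Motives.projectiveSpace 3 k).left.Opens) ∧ (ι.ker.ideal U).IsPrincipal) →
    NoseHypHostedNestEquinodalDirectCILiftSigmaPGBTriplePrime₂ k 3 H ι → ELNatConclusionO k 3 H ι := by
  intro hF hp k _ _ _ H ι hι hH hloc hν
  haveI := hι; haveI := hH
  letI := MvPolynomial.gradedAlgebra (σ := Fin (3 + 1)) (R := k)
  obtain ⟨E₀, hE₀, hres⟩ := hν
  -- F4's outer hypothesis on the initial host (the blob's disjunction minus its `¬ range ι ⊆ V₊ ℓ` conjunct); read by JINIT (ν4) and by HSUBᵈ (ν3ᵈ)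
  have hE₀' : E₀ = ∅ ∨ ∃ ℓ₀ : MvPolynomial (Fin (3 + 1)) k, ℓ₀.IsHomogeneous 1 ∧ ℓ₀ ≠ 0 ∧
      E₀ = {y : (Literature.AlgebraicGeometry.Motives.projectiveSpace 3 k).left | ℓ₀ ∈ (y : ProjectiveSpectrum (MvPolynomial.homogeneousSubmodule (Fin (3 + 1)) k)).asHomogeneousIdeal} :=
    hE₀.imp id (fun ⟨ℓ₀, h1, h0, _, h⟩ => ⟨ℓ₀, h1, h0, h⟩)
  -- HINIT by cases on the host; everything else is host-independent
  have HINIT : ∀ (O : Type) [CommRing O] [IsDomain O] [IsDiscreteValuationRing O] [IsAdicComplete (IsLocalRing.maximalIdeal O) O]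
      [IsAlgClosed (IsLocalRing.ResidueField O)] (θ : O →+* k), Function.Surjective θ → (letI := MvPolynomial.gradedAlgebra (σ := Fin (3 + 1)) (R := O);
      letI := MvPolynomial.gradedAlgebra (σ := Fin (3 + 1)) (R := k); ∀ (φ : MvPolynomial.homogeneousSubmodule (Fin (3 + 1)) O →+*ᵍ MvPolynomial.homogeneousSubmodule (Fin (3 + 1)) k)
        (hφ' : HomogeneousIdeal.irrelevant (MvPolynomial.homogeneousSubmodule (Fin (3 + 1)) k) ≤ (HomogeneousIdeal.irrelevant (MvPolynomial.homogeneousSubmodule (Fin (3 + 1)) O)).map φ), (∀ s, φ s = MvPolynomial.map θ s) →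
        TCPlus.LetterDatum O (AlgebraicGeometry.Proj (MvPolynomial.homogeneousSubmodule (Fin (3 + 1)) O)) (AlgebraicGeometry.Proj.toSpecZero (MvPolynomial.homogeneousSubmodule (Fin (3 + 1)) O) ≫ AlgebraicGeometry.Spec.map (CommRingCat.ofHom (algebraMap O (MvPolynomial.homogeneousSubmodule (Fin (3 + 1)) O 0)))) (Set.range (ι ≫ AlgebraicGeometry.Proj.map φ hφ' : H ⟶ (AlgebraicGeometry.Proj (MvPolynomial.homogeneousSubmodule (Fin (3 + 1)) O)))) (Literature.AlgebraicGeometry.Motives.projectiveSpace 3 k).left (AlgebraicGeometry.Proj (MvPolynomial.homogeneousSubmodule (Fin (3 + 1)) O)) (𝟙 (AlgebraicGeometry.Proj (MvPolynomial.homogeneousSubmodule (Fin (3 + 1)) O))) (AlgebraicGeometry.Proj.map φ hφ' : (Literature.AlgebraicGeometry.Motives.projectiveSpace 3 k).left ⟶ (AlgebraicGeometry.Proj (MvPolynomial.homogeneousSubmodule (Fin (3 + 1)) O))) E₀) := by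
    rcases hE₀ with rfl | ⟨ℓ, hℓ1, hℓ0, hHℓ, rfl⟩
    · exact hinit_empty k 3 H ι
    · exact hinit_hyperplane k 2 H ι ℓ hℓ1 hℓ0 hHℓ
  exact target_elnat_of_hostedSubchainResolutionᵢ p hp k 3 H ι hι hH hloc E₀ ReachHostedNoseBTriplePrime
    (fun ℓ F₉ β T₉ E₉ => ((ReachEquinodalPlanarNose₂ k 3 ℓ (Set.range ι) F₉ β T₉ E₉ ∨ ReachDirectPlanarNoseSigmaPG₂ k 3 ℓ (Set.range ι) F₉ β T₉ E₉) ∨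
      ReachDirectCINoseSigmaPG₂ k 3 (Set.range ι) F₉ β T₉ E₉) ∨ ReachLiftNoseSigmaPG₂ k 3 H ι (Set.range ι) F₉ β T₉ E₉)
    HINIT (TCPlus.hpt_seam k 3) (TCPlus.hround_seam k hF) (hsubh_reachHostedNoseBTriplePrime_of_embeddedCurveLiftFact hF k)
    (fun O _ _ _ _ _ θ hθ φ hφ' hφ Ch hChStep hChSplit hYsp hYirr hYcl hPint hPnoeth hPreg hqprop hqsm hCh₀ h𝓔₀ ℓ' F₉ β T₉ E₉ hE₀ hR =>
      hR.elim (fun hR => hR.elim (fun hR => hR.elim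
        (fun hR => Equinodal.hsube_of_suppliers hF k O θ hθ _ _ _ Ch hChStep hChSplit hYsp hYirr hYcl hPint hPnoeth hPreg hqprop hqsm ℓ' (Set.range ι)
          (Equinodal.RPlus k O θ _ _ _ Ch)
          (Equinodal.jinit_rPlus₀_of_nearNode k H ι hι hH _ hE₀' (Equinodal.nose_regular_near_node k) O θ hθ φ hφ' hφ Ch hChStep hChSplit hYsp hYirr hYcl
            hPint hPnoeth hPreg hqprop hqsm hCh₀ h𝓔₀ ℓ' hE₀)
          (Equinodal.hnode_rPlus k O θ hθ _ _ _ Ch hChStep hChSplit hYsp hYirr hYcl hPint hPnoeth hPreg hqprop hqsm)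
          (Equinodal.hrdz_rPlus k O θ hθ _ _ _ Ch hChStep hChSplit hYsp hYirr hYcl hPint hPnoeth hPreg hqprop hqsm (hF k O θ hθ _ _))
          (Equinodal.hend_rPlus k O θ _ _ _ Ch) F₉ β T₉ E₉ hR)
        (fun hR => Direct.hsubd_sigmaPG_of_smoothing hF k H ι hι hH E₀ hE₀' O θ hθ (SecCurve.secCurveLift k O θ hθ) φ hφ' hφ Ch hChStep hChSplit hYsp hYirr hYcl hPint
          hPnoeth hPreg hqprop hqsm hCh₀ h𝓔₀ ℓ' F₉ β T₉ E₉ hE₀ hR))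
        (fun hR => Direct.hsubci_sigmaPG_of_smoothing hF k H ι hι hH E₀ O θ hθ (SecCurve.secCurveLift k O θ hθ) φ hφ' hφ Ch hChStep hChSplit hYsp hYirr hYcl hPint hPnoeth
          hPreg hqprop hqsm hCh₀ h𝓔₀ ℓ' F₉ β T₉ E₉ hE₀ hR))
        (fun hR => LiftNose.hsublift_of_door hF k H ι hι hH E₀ O θ hθ (SecCurve.secCurveLift k O θ hθ) φ hφ' hφ Ch hChStep hChSplit hYsp hYirr hYcl hPint hPnoeth
          hPreg hqprop hqsm hCh₀ h𝓔₀ ℓ' F₉ β T₉ E₉ hE₀ hR))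
    hres

end Summit.ResolutionOfSingularities.ResolutionOfSingularities.Cruxes.EquisingularLiftNat.Sections

end
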